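import Mathlib
import Summits.Ventures.FusionMHD.Models.FluxSurfacePolarRayAmpere
import Summits.Ventures.FusionMHD.Models.FluxSurfacePolarRayLevelGGJMercier
import HarnessLib

/-!
# Polar-ray chart, LEVEL direction (VIII): the SURFACE-AVERAGED FORCE BALANCE `p′V′ + I′Ψ′ − K′Φ′ = 0` of the (8.134) record of an
# implicit surface (from Ampère's law `μ₀I = C·V/2π` and `dV/du = V′`), hence label covariance and the Glasser–Greene–Johnson index
# `D_I` of the surface in the printed Hamada label — in SIX registers

LADDER-GRIDFUSION (F2 item R2 / F1 on the Cerfon–Freidberg rung; F3 scoping input), cell `gridfusion`, seat `gridfusion-model-7` (g6),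
2026-08-27.  Companion of `Models/FluxSurfacePolarRayAmpere.lean` (`toroidalCurrentE_eq_torVolume`),
`Models/FluxSurfacePolarRayLevelVolume.lean` (`LevelLoop.hasDerivAt_torVolume`) and `Models/FluxSurfacePolarRayLevelGGJ{,Mercier}.lean`
(`PolarRay.ggjData`, `mercierRegisterForm`).  Conventions and the three-column framing as stated there once.

WHAT IS PROVED ([folklore] calculus + the printed functionals):
* §1 `LevelLoop.continuousOn_curKernel_rayRadius`, `LevelLoop.currentIntegrand_intervalIntegrable` (the current integrand of the
  Current file along the glued loop is continuous on the period, given the gradient-squared field `G`), and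
  **`LevelLoop.toroidalCurrentE_eq_torVolume`**: for EVERY admissible level `u` of a loop of level panels whose flux has a radial
  field `D` on `ℝ × [0, s_max]` (boxes inside), a tangential field `k·R = D_t`, and the divergence primitive
  `∂_s(sD/R) = C·s·R − ∂_θk` there (polar form of `Δ*ψ = C·R²`): `μ₀·I(u) = C·torVolume(u)/2π`.
* §2 **`LevelLoop.hasDerivAt_toroidalCurrentJ_forceBalance`**: `dI/du = (C/2π)·V′(u₀)`; **`LevelLoop.ggjData_isForceBalanced`**:
  `(ggjData g C ψ R_c Z_c u₀).IsForceBalanced` — Kruskal–Kulsrud's surface-averaged force balance (Jardin/Zheng (1.25)) for the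
  implicit surface, a THEOREM (not an input).
* §3 Consequences BY NAME from lit-3's `MercierFluxForm.lean`: label covariance of the criterion (`mercierCriterion_ggjData_relabel_iff`),
  the volume (Hamada) relabelling, **`ggjDI_ggjData_eq_registerForm`**: the printed GGJ ideal index of the surface,
  `D_I = −mercierRegisterForm/(4g²Pd²)` in the six registers of `mercierNumerator_ggjData` (any `⟨σB²⟩`, `⟨B²⟩` inputs — they cancel in
  `D_I`), and `ggjStable_ggjData_iff` (`−D_I > 0 ⟺ 0 < mercierRegisterForm`).
MODELLED: ideal MHD, Solov'ev-class profiles (`F ≡ g`, `Δ*Ψ = C·R²`), nested star-shaped surfaces; `D_I` is the printed index of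
the GGJ singular-layer theory evaluated on MODEL inputs; NECESSARY-criterion statements about a MODEL, never a device.  NOT CLAIMED:
any value; the resistive index `D_R` (needs the two further averages `⟨σB²⟩ = Cg`, `⟨B²⟩` — one more kernel; next file).
-/

noncomputable section

open Real Set Filter Topology MeasureTheory intervalIntegral
open scoped Interval
open Literature.MathematicalPhysics.MHD Literature.MathematicalPhysics.MHD.GradShafranov
  Literature.MathematicalPhysics.MHD.FluxGeometry Literature.MathematicalPhysics.MHD.Mercier.FluxForm

namespace Summit.Ventures.FusionMHD.Models

namespace PolarRay

namespace LevelLoop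

variable {ψ : ℝ → ℝ → ℝ} {Rc Zc uin uout smax C : ℝ} {D D₁ G k kθ : ℝ → ℝ → ℝ} {N : ℕ} {t σ₁ σ₂ : ℕ → ℝ}
  {L : ℝ → ℝ → (ℝ × ℝ →L[ℝ] ℝ)}

/-! ## §1 Ampère's law at every admissible level of a loop of level panels -/

/-- `θ ↦ curKernel(θ, ρ_u θ)` is continuous on the period (panel continuity glued; `G` jointly continuous on the boxes). [folklore] -/
theorem continuousOn_curKernel_rayRadius (Λ : LevelLoop ψ Rc Zc uin uout D N t σ₁ σ₂)
    (hR : ∀ j < N, ∀ θ ∈ Icc (t j) (t (j + 1)), ∀ s ∈ Icc (σ₁ j) (σ₂ j), 0 < Rc + s * cos θ)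
    (hGc : ∀ j < N, ContinuousOn (fun p : ℝ × ℝ => G p.1 p.2) (Icc (t j) (t (j + 1)) ×ˢ Icc (σ₁ j) (σ₂ j)))
    {u : ℝ} (hu : u ∈ Ioo uin uout) :
    ContinuousOn (fun θ => curKernel Rc D G θ (rayRadius ψ Rc Zc u θ)) (Icc 0 (2 * π)) := by
  have h := (continuousOn_Icc_of_chain (f := fun θ => curKernel Rc D G θ (rayRadius ψ Rc Zc u θ)) N Λ.mono
    fun j hj => (Λ.panel j hj).continuousOn_kernel
      (continuousOn_curKernel (Λ.panel j hj).slopeCont (hGc j hj)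
        (fun p hp => ((Λ.panel j hj).slopePos p.1 hp.1 p.2 hp.2).ne') (fun p hp => (hR j hj p.1 hp.1 p.2 hp.2).ne')) hu).2
  rwa [Λ.t_zero, Λ.t_last] at h

/-- The current integrand of the Current file's §1 along the glued loop is interval-integrable on the period (it equals
`curKernel(θ, ρ_u θ)` there). [folklore] -/
theorem currentIntegrand_intervalIntegrable (Λ : LevelLoop ψ Rc Zc uin uout D N t σ₁ σ₂)
    (hψ : ∀ j < N, ∀ θ ∈ Icc (t j) (t (j + 1)), ∀ s ∈ Icc (σ₁ j) (σ₂ j),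
      HasFDerivAt (fun p : ℝ × ℝ => ψ p.1 p.2) (L θ s) (rayPoint Rc Zc θ s))
    (hR : ∀ j < N, ∀ θ ∈ Icc (t j) (t (j + 1)), ∀ s ∈ Icc (σ₁ j) (σ₂ j), 0 < Rc + s * cos θ)
    (hG : ∀ j < N, ∀ θ ∈ Icc (t j) (t (j + 1)), ∀ s ∈ Icc (σ₁ j) (σ₂ j), (L θ s (1, 0)) ^ 2 + (L θ s (0, 1)) ^ 2 = G θ s)
    (hGc : ∀ j < N, ContinuousOn (fun p : ℝ × ℝ => G p.1 p.2) (Icc (t j) (t (j + 1)) ×ˢ Icc (σ₁ j) (σ₂ j)))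
    {u : ℝ} (hu : u ∈ Ioo uin uout) :
    IntervalIntegrable (fun θ => ((L θ (rayRadius ψ Rc Zc u θ) (1, 0)) ^ 2 + (L θ (rayRadius ψ Rc Zc u θ) (0, 1)) ^ 2)
      * (rayRadius ψ Rc Zc u θ / ((loop Rc Zc (rayRadius ψ Rc Zc u) θ).1
        * |radialDeriv (L θ (rayRadius ψ Rc Zc u θ) (1, 0)) (L θ (rayRadius ψ Rc Zc u θ) (0, 1)) θ|))) volume 0 (2 * π) := by
  obtain ⟨-, -, hDeq, -, -⟩ := Λ.loop_hyps hψ hR hu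
  have hI : uIcc 0 (2 * π) = Icc 0 (2 * π) := uIcc_of_le two_pi_pos.le
  have hc : IntervalIntegrable (fun θ => curKernel Rc D G θ (rayRadius ψ Rc Zc u θ)) volume 0 (2 * π) :=
    ContinuousOn.intervalIntegrable (by rw [hI]; exact Λ.continuousOn_curKernel_rayRadius hR hGc hu)
  refine hc.congr fun θ hθ => ?_
  have hθ' : θ ∈ uIcc 0 (2 * π) := by
    rw [hI]; rw [uIoc_of_le two_pi_pos.le] at hθ; exact Ioc_subset_Icc_self hθ
  have hθI : θ ∈ Icc 0 (2 * π) := by rwa [hI] at hθ'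
  obtain ⟨j, hj, hθj⟩ := Λ.exists_panel hθI
  have hmem : rayRadius ψ Rc Zc u θ ∈ Icc (σ₁ j) (σ₂ j) := Ioo_subset_Icc_self ((Λ.panel j hj).spec hu hθj).1
  show curKernel Rc D G θ (rayRadius ψ Rc Zc u θ) = _
  rw [hG j hj θ hθj _ hmem, (hDeq θ hθ').1, abs_of_pos (hDeq θ hθ').2]
  rfl

/-- **AMPÈRE'S LAW AT EVERY ADMISSIBLE LEVEL**: `toroidalCurrentE μ₀ ψ (loop R_c Z_c ρ_u) (2π) = C·torVolume ψ R_c Z_c u/(2πμ₀)`.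
Hypotheses: the loop of level panels `Λ`, the Fréchet derivative `L θ s` of `ψ` on the boxes, `R > 0` there, the gradient-squared
field `G` (identified on the boxes, jointly continuous), all brackets inside `(0, s_max)`; and on `ℝ × [0, s_max]`: the radial field
`D` extended, a tangential field `k` with `k·R = D_t` on the boxes, `k`, `∂_θk` jointly continuous, `k(2π,·) = k(0,·)`, and the
divergence primitive `∂_s(sD/R) = C·s·R − ∂_θk` (polar form of `Δ*ψ = C·R²`). [cite: Freidberg2014, §6.3.3 eq. (6.27)] -/
theorem toroidalCurrentE_eq_torVolume (Λ : LevelLoop ψ Rc Zc uin uout D N t σ₁ σ₂) (μ0 : ℝ)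
    (hψ : ∀ j < N, ∀ θ ∈ Icc (t j) (t (j + 1)), ∀ s ∈ Icc (σ₁ j) (σ₂ j),
      HasFDerivAt (fun p : ℝ × ℝ => ψ p.1 p.2) (L θ s) (rayPoint Rc Zc θ s))
    (hR : ∀ j < N, ∀ θ ∈ Icc (t j) (t (j + 1)), ∀ s ∈ Icc (σ₁ j) (σ₂ j), 0 < Rc + s * cos θ)
    (hG : ∀ j < N, ∀ θ ∈ Icc (t j) (t (j + 1)), ∀ s ∈ Icc (σ₁ j) (σ₂ j), (L θ s (1, 0)) ^ 2 + (L θ s (0, 1)) ^ 2 = G θ s)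
    (hGc : ∀ j < N, ContinuousOn (fun p : ℝ × ℝ => G p.1 p.2) (Icc (t j) (t (j + 1)) ×ˢ Icc (σ₁ j) (σ₂ j)))
    (hσ : ∀ j < N, σ₂ j ≤ smax)
    (hk : ∀ j < N, ∀ θ ∈ Icc (t j) (t (j + 1)), ∀ s ∈ Icc (σ₁ j) (σ₂ j),
      k θ s * (Rc + s * cos θ) = tangentialDeriv (L θ s (1, 0)) (L θ s (0, 1)) θ)
    (hkc : ContinuousOn (fun p : ℝ × ℝ => k p.1 p.2) (univ ×ˢ Icc 0 smax))
    (hkθc : ContinuousOn (fun p : ℝ × ℝ => kθ p.1 p.2) (univ ×ˢ Icc 0 smax))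
    (hkθ : ∀ θ : ℝ, ∀ σ ∈ Icc 0 smax, HasDerivAt (fun θ' => k θ' σ) (kθ θ σ) θ)
    (hkper : ∀ σ : ℝ, k (2 * π) σ = k 0 σ)
    (hm : ∀ θ : ℝ, ∀ σ ∈ Icc 0 smax,
      HasDerivAt (fun s => s * D θ s / (Rc + s * cos θ)) (C * σ * (Rc + σ * cos θ) - kθ θ σ) σ)
    {u : ℝ} (hu : u ∈ Ioo uin uout) :
    toroidalCurrentE μ0 ψ (loop Rc Zc (rayRadius ψ Rc Zc u)) (2 * π) = 1 / μ0 * (C / (2 * π) * torVolume ψ Rc Zc u) := by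
  obtain ⟨hρ0, hψ', hDeq, -, hR'⟩ := Λ.loop_hyps hψ hR hu
  have hI : uIcc 0 (2 * π) = Icc 0 (2 * π) := uIcc_of_le two_pi_pos.le
  have hlev : ∀ θ ∈ Icc 0 (2 * π), rayProfile ψ Rc Zc θ (rayRadius ψ Rc Zc u θ) = u :=
    fun θ hθ => (Λ.surface_facts hu hθ).1
  have hpanel : ∀ θ ∈ Icc 0 (2 * π), ∃ j < N, θ ∈ Icc (t j) (t (j + 1)) ∧ rayRadius ψ Rc Zc u θ ∈ Ioo (σ₁ j) (σ₂ j) :=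
    fun θ hθ => by
      obtain ⟨j, hj, hθj⟩ := Λ.exists_panel hθ
      exact ⟨j, hj, hθj, ((Λ.panel j hj).spec hu hθj).1⟩
  have hρI : ∀ θ ∈ Icc 0 (2 * π), rayRadius ψ Rc Zc u θ ∈ Ioo 0 smax := fun θ hθ => by
    obtain ⟨j, hj, -, hρ⟩ := hpanel θ hθ
    exact ⟨(Λ.panel j hj).hs₁.trans hρ.1, hρ.2.trans_le (hσ j hj)⟩
  have hk' : ∀ θ ∈ uIcc 0 (2 * π), k θ (rayRadius ψ Rc Zc u θ) * (Rc + rayRadius ψ Rc Zc u θ * cos θ)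
      = tangentialDeriv (L θ (rayRadius ψ Rc Zc u θ) (1, 0)) (L θ (rayRadius ψ Rc Zc u θ) (0, 1)) θ := fun θ hθ => by
    rw [hI] at hθ
    obtain ⟨j, hj, hθj, hρ⟩ := hpanel θ hθ
    exact hk j hj θ hθj _ (Ioo_subset_Icc_self hρ)
  have hRr : ∀ θ ∈ uIcc 0 (2 * π), 0 < Rc + rayRadius ψ Rc Zc u θ * cos θ := hR'
  exact PolarRay.toroidalCurrentE_eq_torVolume (L := fun θ => L θ (rayRadius ψ Rc Zc u θ)) μ0 hlev
    (Λ.continuousOn_rayRadius hu) hρI hψ' (fun θ hθ => ⟨(hDeq θ hθ).1.symm, (hDeq θ hθ).2⟩) hk' hRr hkc hkθc hkθ hkper hm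
    (Λ.currentIntegrand_intervalIntegrable hψ hR hG hGc hu)

/-! ## §2 Force balance -/

/-- **`dI/du = (C/2π)·V′`** at an admissible level: the derivative of Jardin's `I` (5.34) through nearby levels is `C/2π` times
`V′ = volumeDerivE` (Ampère at every nearby level + the Volume file's `dV/du = V′`). [cite: Jardin2010, §5.3 eq. (5.34)] -/
theorem hasDerivAt_toroidalCurrentJ_forceBalance (Λ : LevelLoop ψ Rc Zc uin uout D N t σ₁ σ₂)
    (hψ : ∀ j < N, ∀ θ ∈ Icc (t j) (t (j + 1)), ∀ s ∈ Icc (σ₁ j) (σ₂ j),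
      HasFDerivAt (fun p : ℝ × ℝ => ψ p.1 p.2) (L θ s) (rayPoint Rc Zc θ s))
    (hR : ∀ j < N, ∀ θ ∈ Icc (t j) (t (j + 1)), ∀ s ∈ Icc (σ₁ j) (σ₂ j), 0 < Rc + s * cos θ)
    (hG : ∀ j < N, ∀ θ ∈ Icc (t j) (t (j + 1)), ∀ s ∈ Icc (σ₁ j) (σ₂ j), (L θ s (1, 0)) ^ 2 + (L θ s (0, 1)) ^ 2 = G θ s)
    (hGc : ∀ j < N, ContinuousOn (fun p : ℝ × ℝ => G p.1 p.2) (Icc (t j) (t (j + 1)) ×ˢ Icc (σ₁ j) (σ₂ j)))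
    (hσ : ∀ j < N, σ₂ j ≤ smax)
    (hk : ∀ j < N, ∀ θ ∈ Icc (t j) (t (j + 1)), ∀ s ∈ Icc (σ₁ j) (σ₂ j),
      k θ s * (Rc + s * cos θ) = tangentialDeriv (L θ s (1, 0)) (L θ s (0, 1)) θ)
    (hkc : ContinuousOn (fun p : ℝ × ℝ => k p.1 p.2) (univ ×ˢ Icc 0 smax))
    (hkθc : ContinuousOn (fun p : ℝ × ℝ => kθ p.1 p.2) (univ ×ˢ Icc 0 smax))
    (hkθ : ∀ θ : ℝ, ∀ σ ∈ Icc 0 smax, HasDerivAt (fun θ' => k θ' σ) (kθ θ σ) θ)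
    (hkper : ∀ σ : ℝ, k (2 * π) σ = k 0 σ)
    (hm : ∀ θ : ℝ, ∀ σ ∈ Icc 0 smax,
      HasDerivAt (fun s => s * D θ s / (Rc + s * cos θ)) (C * σ * (Rc + σ * cos θ) - kθ θ σ) σ)
    {u₀ : ℝ} (hu₀ : u₀ ∈ Ioo uin uout) :
    HasDerivAt (fun u => toroidalCurrentJ 1 ψ (loop Rc Zc (rayRadius ψ Rc Zc u)) (2 * π))
      (C / (2 * π) * volumeDerivE ψ (loop Rc Zc (rayRadius ψ Rc Zc u₀)) (2 * π)) u₀ := by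
  have hev : (fun u => toroidalCurrentJ 1 ψ (loop Rc Zc (rayRadius ψ Rc Zc u)) (2 * π))
      =ᶠ[𝓝 u₀] fun u => C / (2 * π) * torVolume ψ Rc Zc u := by
    filter_upwards [Ioo_mem_nhds hu₀.1 hu₀.2] with u hu
    rw [toroidalCurrentJ_eq_toroidalCurrentE (Λ.volumeDerivE_pos hψ hR hu).ne' 1,
      Λ.toroidalCurrentE_eq_torVolume 1 hψ hR hG hGc hσ hk hkc hkθc hkθ hkper hm hu, one_div_one, one_mul]
  exact ((Λ.hasDerivAt_torVolume hψ hR hu₀).const_mul (C / (2 * π))).congr_of_eventuallyEq hev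

/-- **THE SURFACE-AVERAGED FORCE BALANCE `p′V′ + I′Ψ′ − K′Φ′ = 0` HOLDS for the (8.134) record of the implicit surface**
(`p′ = −C`, `Ψ′ = 2π`, `K′ = 0`, `I′ = (C/2π)V′`) — Kruskal–Kulsrud's identity, here a THEOREM from Ampère's law on the glued loop;
it makes the criterion label-independent and the GGJ indices the printed ones (`MercierFluxForm.lean` §3–§5).
[cite: Jardin2010, §8.5.4 eq. (8.134)] -/
theorem ggjData_isForceBalanced (Λ : LevelLoop ψ Rc Zc uin uout D N t σ₁ σ₂) (g : ℝ)
    (hψ : ∀ j < N, ∀ θ ∈ Icc (t j) (t (j + 1)), ∀ s ∈ Icc (σ₁ j) (σ₂ j),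
      HasFDerivAt (fun p : ℝ × ℝ => ψ p.1 p.2) (L θ s) (rayPoint Rc Zc θ s))
    (hR : ∀ j < N, ∀ θ ∈ Icc (t j) (t (j + 1)), ∀ s ∈ Icc (σ₁ j) (σ₂ j), 0 < Rc + s * cos θ)
    (hG : ∀ j < N, ∀ θ ∈ Icc (t j) (t (j + 1)), ∀ s ∈ Icc (σ₁ j) (σ₂ j), (L θ s (1, 0)) ^ 2 + (L θ s (0, 1)) ^ 2 = G θ s)
    (hGc : ∀ j < N, ContinuousOn (fun p : ℝ × ℝ => G p.1 p.2) (Icc (t j) (t (j + 1)) ×ˢ Icc (σ₁ j) (σ₂ j)))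
    (hσ : ∀ j < N, σ₂ j ≤ smax)
    (hk : ∀ j < N, ∀ θ ∈ Icc (t j) (t (j + 1)), ∀ s ∈ Icc (σ₁ j) (σ₂ j),
      k θ s * (Rc + s * cos θ) = tangentialDeriv (L θ s (1, 0)) (L θ s (0, 1)) θ)
    (hkc : ContinuousOn (fun p : ℝ × ℝ => k p.1 p.2) (univ ×ˢ Icc 0 smax))
    (hkθc : ContinuousOn (fun p : ℝ × ℝ => kθ p.1 p.2) (univ ×ˢ Icc 0 smax))
    (hkθ : ∀ θ : ℝ, ∀ σ ∈ Icc 0 smax, HasDerivAt (fun θ' => k θ' σ) (kθ θ σ) θ)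
    (hkper : ∀ σ : ℝ, k (2 * π) σ = k 0 σ)
    (hm : ∀ θ : ℝ, ∀ σ ∈ Icc 0 smax,
      HasDerivAt (fun s => s * D θ s / (Rc + s * cos θ)) (C * σ * (Rc + σ * cos θ) - kθ θ σ) σ)
    {u₀ : ℝ} (hu₀ : u₀ ∈ Ioo uin uout) :
    (ggjData g C ψ Rc Zc u₀).IsForceBalanced := by
  unfold SurfaceData.IsForceBalanced
  have hI' : (ggjData g C ψ Rc Zc u₀).I' = C / (2 * π) * volumeDerivE ψ (loop Rc Zc (rayRadius ψ Rc Zc u₀)) (2 * π) :=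
    (Λ.hasDerivAt_toroidalCurrentJ_forceBalance hψ hR hG hGc hσ hk hkc hkθc hkθ hkper hm hu₀).deriv
  rw [hI', show (ggjData g C ψ Rc Zc u₀).p' = -C from rfl, show (ggjData g C ψ Rc Zc u₀).Ψ' = 2 * π from rfl,
    show (ggjData g C ψ Rc Zc u₀).K' = 0 from rfl,
    show (ggjData g C ψ Rc Zc u₀).V' = volumeDerivE ψ (loop Rc Zc (rayRadius ψ Rc Zc u₀)) (2 * π) from rfl]
  have hπ : (2 * π : ℝ) ≠ 0 := two_pi_pos.ne'
  have e : C / (2 * π) * volumeDerivE ψ (loop Rc Zc (rayRadius ψ Rc Zc u₀)) (2 * π) * (2 * π)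
      = C * volumeDerivE ψ (loop Rc Zc (rayRadius ψ Rc Zc u₀)) (2 * π) := by
    field_simp
  linear_combination e

/-! ## §3 Consequences: label covariance and the GGJ ideal index of the surface in six registers -/

/-- LABEL COVARIANCE of the criterion on the implicit surface: for any relabelling `ψ̃ = h(u)` (`h′ = h1 ≠ 0`, `h″ = h2`) the criterion
of the relabelled record is the same (lit-3's `mercierCriterion_relabel_iff`, discharged by the force balance just proved).
[cite: Jardin2010, §8.5.4 eq. (8.134)] -/
theorem mercierCriterion_ggjData_relabel_iff (Λ : LevelLoop ψ Rc Zc uin uout D N t σ₁ σ₂) (g : ℝ)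
    (hψ : ∀ j < N, ∀ θ ∈ Icc (t j) (t (j + 1)), ∀ s ∈ Icc (σ₁ j) (σ₂ j),
      HasFDerivAt (fun p : ℝ × ℝ => ψ p.1 p.2) (L θ s) (rayPoint Rc Zc θ s))
    (hR : ∀ j < N, ∀ θ ∈ Icc (t j) (t (j + 1)), ∀ s ∈ Icc (σ₁ j) (σ₂ j), 0 < Rc + s * cos θ)
    (hG : ∀ j < N, ∀ θ ∈ Icc (t j) (t (j + 1)), ∀ s ∈ Icc (σ₁ j) (σ₂ j), (L θ s (1, 0)) ^ 2 + (L θ s (0, 1)) ^ 2 = G θ s)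
    (hGc : ∀ j < N, ContinuousOn (fun p : ℝ × ℝ => G p.1 p.2) (Icc (t j) (t (j + 1)) ×ˢ Icc (σ₁ j) (σ₂ j)))
    (hσ : ∀ j < N, σ₂ j ≤ smax)
    (hk : ∀ j < N, ∀ θ ∈ Icc (t j) (t (j + 1)), ∀ s ∈ Icc (σ₁ j) (σ₂ j),
      k θ s * (Rc + s * cos θ) = tangentialDeriv (L θ s (1, 0)) (L θ s (0, 1)) θ)
    (hkc : ContinuousOn (fun p : ℝ × ℝ => k p.1 p.2) (univ ×ˢ Icc 0 smax))
    (hkθc : ContinuousOn (fun p : ℝ × ℝ => kθ p.1 p.2) (univ ×ˢ Icc 0 smax))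
    (hkθ : ∀ θ : ℝ, ∀ σ ∈ Icc 0 smax, HasDerivAt (fun θ' => k θ' σ) (kθ θ σ) θ)
    (hkper : ∀ σ : ℝ, k (2 * π) σ = k 0 σ)
    (hm : ∀ θ : ℝ, ∀ σ ∈ Icc 0 smax,
      HasDerivAt (fun s => s * D θ s / (Rc + s * cos θ)) (C * σ * (Rc + σ * cos θ) - kθ θ σ) σ)
    {u₀ : ℝ} (hu₀ : u₀ ∈ Ioo uin uout) {h1 : ℝ} (hh : h1 ≠ 0) (h2 : ℝ) :
    ((ggjData g C ψ Rc Zc u₀).relabel h1 h2).MercierCriterion ↔ (ggjData g C ψ Rc Zc u₀).MercierCriterion :=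
  SurfaceData.mercierCriterion_relabel_iff _ h1 h2 hh (Λ.ggjData_V'_pos g C hψ hR hu₀).ne'
    (Λ.ggjData_isForceBalanced g hψ hR hG hGc hσ hk hkc hkθc hkθ hkper hm hu₀)

/-- **THE PRINTED GLASSER–GREENE–JOHNSON IDEAL INDEX `D_I` OF THE IMPLICIT SURFACE IN SIX REGISTERS.**  For the VOLUME (Hamada)
relabelling of the record (`relabel V′ V″`: `Ṽ′ = 1`, `Ṽ″ = 0`, Zheng (2.62)) and any inputs `⟨σB²⟩`, `⟨B²⟩` (they cancel in `D_I`):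
`D_I = −mercierRegisterForm g C Pd Wd Aσ As AB Ai/(4g²Pd²)` with the six registers of `mercierNumerator_ggjData`
(requires shear, `Pd ≠ 0`).  Route: `D_I + 1/4 = mercierD` of the Hamada data (`mercierD_eq_ggjDI_add`) `= mercierD` of the record
(label-invariant by the force balance, `mercierD_relabel`) `= 1/4 − F·V′²/Λ²` with `4V′²F = 4π²·registerForm`, `Λ = −2πgPd`.
[cite: Zheng2015, §2.3 eq. (2.62)] -/
theorem ggjDI_ggjData_eq_registerForm (Λ : LevelLoop ψ Rc Zc uin uout D N t σ₁ σ₂) (g : ℝ)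
    (hψ : ∀ j < N, ∀ θ ∈ Icc (t j) (t (j + 1)), ∀ s ∈ Icc (σ₁ j) (σ₂ j),
      HasFDerivAt (fun p : ℝ × ℝ => ψ p.1 p.2) (L θ s) (rayPoint Rc Zc θ s))
    (hR : ∀ j < N, ∀ θ ∈ Icc (t j) (t (j + 1)), ∀ s ∈ Icc (σ₁ j) (σ₂ j), 0 < Rc + s * cos θ)
    (hD₁ : ∀ j < N, ∀ θ ∈ Icc (t j) (t (j + 1)), ∀ s ∈ Icc (σ₁ j) (σ₂ j), HasDerivAt (D θ) (D₁ θ s) s)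
    (hD₁c : ∀ j < N, ContinuousOn (fun p : ℝ × ℝ => D₁ p.1 p.2) (Icc (t j) (t (j + 1)) ×ˢ Icc (σ₁ j) (σ₂ j)))
    (hG : ∀ j < N, ∀ θ ∈ Icc (t j) (t (j + 1)), ∀ s ∈ Icc (σ₁ j) (σ₂ j), (L θ s (1, 0)) ^ 2 + (L θ s (0, 1)) ^ 2 = G θ s)
    (hGc : ∀ j < N, ContinuousOn (fun p : ℝ × ℝ => G p.1 p.2) (Icc (t j) (t (j + 1)) ×ˢ Icc (σ₁ j) (σ₂ j)))
    (hGS : ∀ j < N, ∀ θ ∈ Icc (t j) (t (j + 1)), ∀ s ∈ Icc (σ₁ j) (σ₂ j),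
      gsOperator ψ (Rc + s * cos θ) (Zc + s * sin θ) = C * (Rc + s * cos θ) ^ 2)
    (hσ : ∀ j < N, σ₂ j ≤ smax)
    (hk : ∀ j < N, ∀ θ ∈ Icc (t j) (t (j + 1)), ∀ s ∈ Icc (σ₁ j) (σ₂ j),
      k θ s * (Rc + s * cos θ) = tangentialDeriv (L θ s (1, 0)) (L θ s (0, 1)) θ)
    (hkc : ContinuousOn (fun p : ℝ × ℝ => k p.1 p.2) (univ ×ˢ Icc 0 smax))
    (hkθc : ContinuousOn (fun p : ℝ × ℝ => kθ p.1 p.2) (univ ×ˢ Icc 0 smax))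
    (hkθ : ∀ θ : ℝ, ∀ σ ∈ Icc 0 smax, HasDerivAt (fun θ' => k θ' σ) (kθ θ σ) θ)
    (hkper : ∀ σ : ℝ, k (2 * π) σ = k 0 σ)
    (hm : ∀ θ : ℝ, ∀ σ ∈ Icc 0 smax,
      HasDerivAt (fun s => s * D θ s / (Rc + s * cos θ)) (C * σ * (Rc + σ * cos θ) - kθ θ σ) σ)
    {u : ℝ} (hu : u ∈ Ioo uin uout) (hg : g ≠ 0)
    (hPd : (∫ θ in (0 : ℝ)..(2 * π), polarKernelDs Rc D D₁ θ (rayRadius ψ Rc Zc u θ) / D θ (rayRadius ψ Rc Zc u θ)) ≠ 0)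
    (hAB : (ggjData g C ψ Rc Zc u).gB2 ≠ 0) (sB2 B2 : ℝ) :
    ((ggjData g C ψ Rc Zc u).relabel (ggjData g C ψ Rc Zc u).V' (ggjData g C ψ Rc Zc u).V'').ggjDI sB2 B2
      = -(mercierRegisterForm g C
          (∫ θ in (0 : ℝ)..(2 * π), polarKernelDs Rc D D₁ θ (rayRadius ψ Rc Zc u θ) / D θ (rayRadius ψ Rc Zc u θ))
          (∫ θ in (0 : ℝ)..(2 * π), volKernelDs Rc D D₁ θ (rayRadius ψ Rc Zc u θ) / D θ (rayRadius ψ Rc Zc u θ))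
          (∫ θ in (0 : ℝ)..(2 * π), invGradKernel Rc D G θ (rayRadius ψ Rc Zc u θ))
          (∫ θ in (0 : ℝ)..(2 * π), sigmaSqKernel g Rc D G θ (rayRadius ψ Rc Zc u θ))
          (∫ θ in (0 : ℝ)..(2 * π), bsqGradKernel g Rc D G θ (rayRadius ψ Rc Zc u θ))
          (∫ θ in (0 : ℝ)..(2 * π), invBsqKernel g Rc D G θ (rayRadius ψ Rc Zc u θ)))
        / (4 * g ^ 2 * (∫ θ in (0 : ℝ)..(2 * π),
            polarKernelDs Rc D D₁ θ (rayRadius ψ Rc Zc u θ) / D θ (rayRadius ψ Rc Zc u θ)) ^ 2) := by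
  have hN := Λ.mercierNumerator_ggjData g hψ hR hD₁ hD₁c hG hGS hu
  have hΦ2' := Λ.ggjData_Φ'' g C hψ hR hD₁ hD₁c hu
  set Pd := (∫ θ in (0 : ℝ)..(2 * π), polarKernelDs Rc D D₁ θ (rayRadius ψ Rc Zc u θ) / D θ (rayRadius ψ Rc Zc u θ))
    with hPddef
  set Wd := (∫ θ in (0 : ℝ)..(2 * π), volKernelDs Rc D D₁ θ (rayRadius ψ Rc Zc u θ) / D θ (rayRadius ψ Rc Zc u θ))
  set Aσ := (∫ θ in (0 : ℝ)..(2 * π), invGradKernel Rc D G θ (rayRadius ψ Rc Zc u θ))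
  set As := (∫ θ in (0 : ℝ)..(2 * π), sigmaSqKernel g Rc D G θ (rayRadius ψ Rc Zc u θ))
  set AB := (∫ θ in (0 : ℝ)..(2 * π), bsqGradKernel g Rc D G θ (rayRadius ψ Rc Zc u θ))
  set Ai := (∫ θ in (0 : ℝ)..(2 * π), invBsqKernel g Rc D G θ (rayRadius ψ Rc Zc u θ))
  set d := ggjData g C ψ Rc Zc u with hd
  have hV : d.V' ≠ 0 := (Λ.ggjData_V'_pos g C hψ hR hu).ne'
  have hfb : d.IsForceBalanced := Λ.ggjData_isForceBalanced g hψ hR hG hGc hσ hk hkc hkθc hkθ hkper hm hu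
  have hΦ2 : d.Φ'' = g * Pd := hΦ2'
  have hshear : d.shear = -(2 * π) * d.Φ'' := by
    show d.Φ' * d.Ψ'' - d.Ψ' * d.Φ'' = _
    simp only [hd, ggjData]; ring
  have hΛ : d.shear ≠ 0 := by
    rw [hshear, hΦ2]
    exact mul_ne_zero (neg_ne_zero.2 two_pi_pos.ne') (mul_ne_zero hg hPd)
  have hV1 := (d.relabel_volume hV).1
  have hV2 := (d.relabel_volume hV).2
  have hΛ' : (d.relabel d.V' d.V'').shear ≠ 0 := by
    rw [d.shear_relabel _ _ hV]; exact div_ne_zero hΛ (pow_ne_zero 3 hV)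
  have hg' : (d.relabel d.V' d.V'').gB2 ≠ 0 := by
    show d.gB2 / d.V' ^ 2 ≠ 0
    exact div_ne_zero hAB (pow_ne_zero 2 hV)
  have h1 := (d.relabel d.V' d.V'').mercierD_eq_ggjDI_add sB2 B2 hV1 hV2 hΛ' hg'
  have h2 := d.mercierD_relabel d.V' d.V'' hV hV hfb
  have hF := d.mercierF_eq_numerator_div hV
  have hN' : d.mercierNumerator = 4 * π ^ 2 * mercierRegisterForm g C Pd Wd Aσ As AB Ai := hN
  -- D_I = mercierD − 1/4 = −F V′²/Λ²
  have h3 : (d.relabel d.V' d.V'').ggjDI sB2 B2 = -(d.mercierF * d.V' ^ 2 / d.shear ^ 2) := by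
    have : (d.relabel d.V' d.V'').mercierD = 1 / 4 - d.mercierF * d.V' ^ 2 / d.shear ^ 2 := by rw [h2]; rfl
    linarith
  rw [h3, hF, hN', hshear, hΦ2]
  have hπ : (π : ℝ) ≠ 0 := Real.pi_ne_zero
  field_simp
  ring

/-- **`−D_I > 0` (GGJ form of the Mercier criterion, Zheng (2.66)) ON THE IMPLICIT SURFACE ⟺ `0 < mercierRegisterForm`** of the
six registers — the same inequality as Jardin's `F > 0` (`mercierCriterion_ggjData_iff`), now also in the printed Hamada-label
index. [cite: Zheng2015, §2.3 eq. (2.66)] -/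
theorem ggjStable_ggjData_iff (Λ : LevelLoop ψ Rc Zc uin uout D N t σ₁ σ₂) (g : ℝ)
    (hψ : ∀ j < N, ∀ θ ∈ Icc (t j) (t (j + 1)), ∀ s ∈ Icc (σ₁ j) (σ₂ j),
      HasFDerivAt (fun p : ℝ × ℝ => ψ p.1 p.2) (L θ s) (rayPoint Rc Zc θ s))
    (hR : ∀ j < N, ∀ θ ∈ Icc (t j) (t (j + 1)), ∀ s ∈ Icc (σ₁ j) (σ₂ j), 0 < Rc + s * cos θ)
    (hD₁ : ∀ j < N, ∀ θ ∈ Icc (t j) (t (j + 1)), ∀ s ∈ Icc (σ₁ j) (σ₂ j), HasDerivAt (D θ) (D₁ θ s) s)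
    (hD₁c : ∀ j < N, ContinuousOn (fun p : ℝ × ℝ => D₁ p.1 p.2) (Icc (t j) (t (j + 1)) ×ˢ Icc (σ₁ j) (σ₂ j)))
    (hG : ∀ j < N, ∀ θ ∈ Icc (t j) (t (j + 1)), ∀ s ∈ Icc (σ₁ j) (σ₂ j), (L θ s (1, 0)) ^ 2 + (L θ s (0, 1)) ^ 2 = G θ s)
    (hGc : ∀ j < N, ContinuousOn (fun p : ℝ × ℝ => G p.1 p.2) (Icc (t j) (t (j + 1)) ×ˢ Icc (σ₁ j) (σ₂ j)))
    (hGS : ∀ j < N, ∀ θ ∈ Icc (t j) (t (j + 1)), ∀ s ∈ Icc (σ₁ j) (σ₂ j),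
      gsOperator ψ (Rc + s * cos θ) (Zc + s * sin θ) = C * (Rc + s * cos θ) ^ 2)
    (hσ : ∀ j < N, σ₂ j ≤ smax)
    (hk : ∀ j < N, ∀ θ ∈ Icc (t j) (t (j + 1)), ∀ s ∈ Icc (σ₁ j) (σ₂ j),
      k θ s * (Rc + s * cos θ) = tangentialDeriv (L θ s (1, 0)) (L θ s (0, 1)) θ)
    (hkc : ContinuousOn (fun p : ℝ × ℝ => k p.1 p.2) (univ ×ˢ Icc 0 smax))
    (hkθc : ContinuousOn (fun p : ℝ × ℝ => kθ p.1 p.2) (univ ×ˢ Icc 0 smax))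
    (hkθ : ∀ θ : ℝ, ∀ σ ∈ Icc 0 smax, HasDerivAt (fun θ' => k θ' σ) (kθ θ σ) θ)
    (hkper : ∀ σ : ℝ, k (2 * π) σ = k 0 σ)
    (hm : ∀ θ : ℝ, ∀ σ ∈ Icc 0 smax,
      HasDerivAt (fun s => s * D θ s / (Rc + s * cos θ)) (C * σ * (Rc + σ * cos θ) - kθ θ σ) σ)
    {u : ℝ} (hu : u ∈ Ioo uin uout) (hg : g ≠ 0)
    (hPd : (∫ θ in (0 : ℝ)..(2 * π), polarKernelDs Rc D D₁ θ (rayRadius ψ Rc Zc u θ) / D θ (rayRadius ψ Rc Zc u θ)) ≠ 0)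
    (hAB : (ggjData g C ψ Rc Zc u).gB2 ≠ 0) (sB2 B2 : ℝ) :
    ((ggjData g C ψ Rc Zc u).relabel (ggjData g C ψ Rc Zc u).V' (ggjData g C ψ Rc Zc u).V'').GGJStable sB2 B2 ↔
      0 < mercierRegisterForm g C
          (∫ θ in (0 : ℝ)..(2 * π), polarKernelDs Rc D D₁ θ (rayRadius ψ Rc Zc u θ) / D θ (rayRadius ψ Rc Zc u θ))
          (∫ θ in (0 : ℝ)..(2 * π), volKernelDs Rc D D₁ θ (rayRadius ψ Rc Zc u θ) / D θ (rayRadius ψ Rc Zc u θ))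
          (∫ θ in (0 : ℝ)..(2 * π), invGradKernel Rc D G θ (rayRadius ψ Rc Zc u θ))
          (∫ θ in (0 : ℝ)..(2 * π), sigmaSqKernel g Rc D G θ (rayRadius ψ Rc Zc u θ))
          (∫ θ in (0 : ℝ)..(2 * π), bsqGradKernel g Rc D G θ (rayRadius ψ Rc Zc u θ))
          (∫ θ in (0 : ℝ)..(2 * π), invBsqKernel g Rc D G θ (rayRadius ψ Rc Zc u θ)) := by
  unfold SurfaceData.GGJStable
  rw [Λ.ggjDI_ggjData_eq_registerForm g hψ hR hD₁ hD₁c hG hGc hGS hσ hk hkc hkθc hkθ hkper hm hu hg hPd hAB sB2 B2, neg_div,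
    neg_neg]
  have h4 : (0 : ℝ) < 4 * g ^ 2 * (∫ θ in (0 : ℝ)..(2 * π),
      polarKernelDs Rc D D₁ θ (rayRadius ψ Rc Zc u θ) / D θ (rayRadius ψ Rc Zc u θ)) ^ 2 := by positivity
  exact div_pos_iff_of_pos_right h4

end LevelLoop

end PolarRay

end Summit.Ventures.FusionMHD.Models

end
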